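/-
COR-CM (cell pub-hodgecm2, stage 2 of the Hodge ladder) — count-neutral KERNEL COMBINATORICS «the odd-slice transport» (seat
prover-pub-hodgecm2-b23-g36-0, binder prover b23, gen 36; claim ODD-SLICE-TRANSPORT F2, HOME/INBOX.md 2026-08-22T05:31:42Z;
sequel of `CorCM/FaceCensusOddSliceDictionary.lean` p319855).  One bookkeeping definition (`transport`) + one `Equiv`
(`galTOfAut`) and theorems; no geometry beyond the by-name INT2-GEN socket `hgen_of_weightRel_mem_span`
(`CorCM/FaceCharacterSaturation.lean`); no named fact, nothing asserted.  Seat b09's representative-free model of the faithful full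
odd slice (`Census/OddSliceFacesModel.lean` p318768, `Census/OddSliceFacesSquares.lean` p319130: `Ty`, `tw`, `transl`, `δ`,
`pairVec`, `pairs`, `hodge`, `faceVec`, `faceVec_mem`, `transl_faceVec`) is used BY NAME; nothing of theirs is restated or re-filed;
`Interfaces.lean` (C1), every E term, B01 and `Transposition/*` are untouched.
HONEST FRAMING (COORDINATOR RULING — HODGE FRAMING CORRECTION, 2026-08-21T11:55:35Z): `HC_CM` is NOT proved, here or anywhere in
the tree; this file proves no face period; its generation theorem is CONDITIONAL on a generation statement in b09's model.
T5 (coordinator ruling 15:33:56Z (3)): NO named-fact / conjecture-def / summit-side supply binder is INTRODUCED here; binder sets of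
§4: the dictionary datum (θ, hθ, hc) is inhabited for every Galois CM field with group `ℤ/2 × A` by transport of structure (§3,
`autDatum`); `hS` is a statement of b09's finite model (his `OddSliceFacesGenerate.hodge_le_pairs_sup_spanFaces_family`, or a
certificate); `hreads` is INHABITED in the kernel for every finite label family with distinct places (`exists_faces_read`, §2) —
no contradiction derivable; checker: self (prover-pub-hodgecm2-b23-g36-0), 2026-08-22.
-/
import Summits.HodgeConjecture.CorCM.FaceCensusOddSliceDictionary
import HarnessLib

/-!
# The odd-slice transport: generation in b09's model `ℤ^{A → ℤ/2}` gives the INT2-GEN binder `hgen` — no table, no certificate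

Continuation of `CorCM/FaceCensusOddSliceDictionary.lean` (dictionary datum `θ : GalT F ≃ ZMod 2 × A`, multiplicative-to-additive,
`θ conjT = (1,0)`; labels `typeMap θ Ψ : Ty A`, inverse `typeOf`).  A tree face `f = (Φ; π, π′)` READS the label face `(φ; i, j)`
AT `σ` when `typeMap θ (pullType Φ σ) = φ`, `(θ (translate σ π)).2 = i`, `(θ (translate σ π′)).2 = j` (written out; no definition).

* §1 the `ℤ`-linear TRANSPORT `transport θ : ℤ^{Ty A} → ℤ[CMF (GalT F) conjT]`, `e_φ ↦ [typeOf φ]`: b09's divisor pair `pairVec φ`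
  goes into `pairRel` (`transport_pairVec_mem`), b09's face class `faceVec φ i j` goes to the corner indicator
  `weightRel f.corner (fun _ ↦ {σ})` of ANY tree face `f` reading `(φ; i, j)` at `σ` (`transport_faceVec`), and the Galois translate
  `transl g (faceVec φ i j)` to the corner indicator of the SAME face read at the base embedding `θ⁻¹(g) σ₀`
  (`transport_transl_faceVec`) — so Galois twists never have to be enumerated;
* §2 NON-VACUITY: every `(φ; i, j)` with `i ≠ j` is read at `σ₀` by a tree face, every finite label family by a finite face set of at
  most the same size (`exists_face_read`, `exists_faces_read`, via `faceOfG` of `CorCM/CM/LefschetzChar2.lean`);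
* §3 the datum from the automorphism group: `galTOfAut σ₀ : Aut(F) ≃ GalT F`, `g ↦ translate σ₀ (σ₀ ∘ g)`; an `Aut`-datum
  `ε : Aut(F) ≃ ℤ/2 × A` (multiplicative-to-additive, complex conjugation at `σ₀ ↦ (1,0)`) gives the dictionary datum
  `ε ∘ (galTOfAut σ₀)⁻¹` (`autDatum`), under which `σ₀ ∘ g`-reads of types and places are `ε g` (`typeMap_eq_of_autReads`,
  `autDatum_translate`);
* §4 **THE TRANSPORT THEOREM** (`weightRel_mem_of_hodge_le`, `hgen_of_hodge_le`): if in b09's model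
  `hodge A ≤ pairs A ⊔ span ℤ {transl g (faceVec s) | g, s ∈ S}` for a finite label family `S`, and a set `𝒮` of tree faces reads
  every member of `S` at `σ₀`, then the corner indicator of EVERY face of `F` lies in
  `span ℤ {weightRel g.corner (fun _ ↦ {σ}) | g ∈ 𝒮, σ} ⊔ pairRel`, hence the INT2-GEN binder `hgen(𝒮, σ₀)` holds (socket
  `hgen_of_weightRel_mem_span`).  Proof: the corner indicator of `f` is `transport (faceVec φ i j)` for the reading `(φ; i, j)` of `f`
  (§1), `i ≠ j` (`snd_ne_of_face`), `faceVec φ i j ∈ hodge A` (b09's `faceVec_mem`), and `transport` maps `pairs A` into `pairRel` and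
  each `transl g (faceVec s)` onto a corner indicator of the face of `𝒮` reading `s` (§1).

The CLOSED `HodgeConjectureFor` forms over INT2-GEN (`CorCM/FacePeriodsGeneratingSet.lean`) are the sequel
`CorCM/FaceCensusOddSliceClosed.lean`; the instantiation with b09's generating family is `Census/OddSliceFaceTransport.lean`.

References: [cite: Pohlmann1968, Thm. 1]; [cite: Milne1999LefschetzClasses, Thm. 3.2]; [cite: Shimura1998, §8.1 (p. 62)].
-/

noncomputable section

open NumberField NumberField.ComplexEmbedding

namespace Summit.HodgeConjecture.CorCM.FaceCensus.OddSlice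

open Literature.AlgebraicGeometry.Motives (CMType)
open Literature.NumberTheory.ComplexMultiplication.CMTypeOps
open Summit.HodgeConjecture.CorCM.Prior.AllgGroup.RfwfAllgGroup
open Summit.HodgeConjecture.CorCM.Census.OddSliceFacesModel
open Summit.HodgeConjecture.CorCM.Census.OddSliceFacesSquares

variable {F : Type} [Field F] [NumberField F]
variable {A : Type} [AddCommGroup A] [Fintype A] [DecidableEq A]
variable (θ : GalT F ≃ ZMod 2 × A)

/-! ## §1 The linear transport `ℤ^{Ty A} → ℤ[CMF (GalT F) conjT]` -/

/-- **The transport** of exponent vectors of b09's model to the integral group ring of abstract CM types: `e_φ ↦ [typeOf φ]`,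
extended `ℤ`-linearly. [folklore] -/
def transport (hθ : ∀ P Q : GalT F, θ (P * Q) = θ P + θ Q) (hc : θ conjT = (1, 0)) :
    (Ty A → ℤ) →ₗ[ℤ] (CMF (GalT F) conjT →₀ ℤ) :=
  ∑ φ : Ty A, (LinearMap.proj φ : (Ty A → ℤ) →ₗ[ℤ] ℤ).smulRight (Finsupp.single (typeOf θ hθ hc φ) 1)

/-- The transport, evaluated. [folklore] -/
theorem transport_apply (hθ : ∀ P Q : GalT F, θ (P * Q) = θ P + θ Q) (hc : θ conjT = (1, 0)) (v : Ty A → ℤ) :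
    transport θ hθ hc v = ∑ φ : Ty A, v φ • Finsupp.single (typeOf θ hθ hc φ) 1 := by
  simp [transport, LinearMap.sum_apply, LinearMap.smulRight_apply]

/-- The transport of a unit vector: `e_φ ↦ [typeOf φ]`. [folklore] -/
theorem transport_single (hθ : ∀ P Q : GalT F, θ (P * Q) = θ P + θ Q) (hc : θ conjT = (1, 0)) (φ : Ty A) (c : ℤ) :
    transport θ hθ hc (Pi.single φ c) = Finsupp.single (typeOf θ hθ hc φ) c := by
  rw [transport_apply, Finset.sum_eq_single φ]
  · rw [Pi.single_eq_same, Finsupp.smul_single_one]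
  · intro ψ _ hψ
    rw [Pi.single_eq_of_ne hψ, zero_smul]
  · intro h
    exact absurd (Finset.mem_univ φ) h

/-- **Divisor pairs go to pair relations**: `transport (e_φ + e_{φ+1}) = [typeOf φ] + [barCM (typeOf φ)] ∈ pairRel`. [folklore] -/
theorem transport_pairVec_mem (hθ : ∀ P Q : GalT F, θ (P * Q) = θ P + θ Q) (hc : θ conjT = (1, 0)) (φ : Ty A) :
    transport θ hθ hc (pairVec A φ) ∈ (pairRel : Submodule ℤ (CMF (GalT F) conjT →₀ ℤ)) := by
  unfold pairVec
  rw [map_add, transport_single, transport_single, typeOf_add_one]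
  exact Submodule.subset_span ⟨_, rfl⟩

/-- **The corner indicator of a face through the dictionary.**  If the face `f` reads `(φ; i, j)` at `σ` — `typeMap (pullType f.Φ σ) = φ`,
`(θ (translate σ f.p)).2 = i`, `(θ (translate σ f.p′)).2 = j` — then its corner indicator `weightRel f.corner (fun _ ↦ {σ})` is the
transport of b09's face class `faceVec φ i j`. [folklore] -/
theorem transport_faceVec [IsGalois ℚ F] (hθ : ∀ P Q : GalT F, θ (P * Q) = θ P + θ Q) (hc : θ conjT = (1, 0))
    (f : Face F) (σ : F →+* ℂ) {φ : Ty A} {i j : A}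
    (hΦ : typeMap θ (pullType f.Φ σ) = φ) (hp : (θ (translate σ f.p)).2 = i) (hq : (θ (translate σ f.p')).2 = j) :
    transport θ hθ hc (faceVec A φ i j) = weightRel f.corner (fun _ => ({σ} : Finset (F →+* ℂ))) := by
  obtain ⟨h0, h1, h2, h3⟩ := typeMap_corner θ hθ hc f σ
  simp only [hΦ, hp, hq] at h0 h1 h2 h3
  have e0 : pullType (f.corner 0) σ = typeOf θ hθ hc φ := by rw [← h0, typeOf_typeMap]
  have e1 : pullType (f.corner 1) σ = typeOf θ hθ hc (φ + 1 + δ A i) := by rw [← h1, typeOf_typeMap]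
  have e2 : pullType (f.corner 2) σ = typeOf θ hθ hc (φ + 1 + δ A j) := by rw [← h2, typeOf_typeMap]
  have e3 : pullType (f.corner 3) σ = typeOf θ hθ hc (φ + δ A i + δ A j) := by rw [← h3, typeOf_typeMap]
  unfold faceVec weightRel
  rw [map_add, map_add, map_add, transport_single, transport_single, transport_single, transport_single,
    Fin.sum_univ_four]
  simp only [Finset.sum_singleton]
  rw [e0, e1, e2, e3]

/-- **Galois translates are base changes.**  If `f` reads `(φ; i, j)` at `σ₀`, then b09's translate `transl g (faceVec φ i j)` of its
class is the corner indicator of the SAME face read at the base embedding `θ⁻¹(g) σ₀`. [folklore] -/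
theorem transport_transl_faceVec [IsGalois ℚ F] (hθ : ∀ P Q : GalT F, θ (P * Q) = θ P + θ Q) (hc : θ conjT = (1, 0))
    (f : Face F) (σ₀ : F →+* ℂ) {φ : Ty A} {i j : A}
    (hΦ : typeMap θ (pullType f.Φ σ₀) = φ) (hp : (θ (translate σ₀ f.p)).2 = i) (hq : (θ (translate σ₀ f.p')).2 = j)
    (g : ZMod 2 × A) :
    transport θ hθ hc (transl A g (faceVec A φ i j)) =
      weightRel f.corner (fun _ => ({(θ.symm g).1 σ₀} : Finset (F →+* ℂ))) := by
  obtain ⟨h1, h2, h3⟩ := reads_baseChange θ hθ hc f σ₀ (θ.symm g) hΦ hp hq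
  rw [θ.apply_symm_apply] at h1 h2 h3
  rw [transl_faceVec]
  exact transport_faceVec θ hθ hc f _ h1 h2 h3

/-! ## §2 Non-vacuity: every label face `(φ; i, j)`, `i ≠ j`, is read by a tree face -/

omit [Fintype A] [DecidableEq A] in
/-- **Every `(φ; i, j)` with `i ≠ j` is read at `σ₀` by a face of `F`** (the face `faceOfG σ₀ (typeOf φ) θ⁻¹(0,i) θ⁻¹(0,j)` of
`CorCM/CM/LefschetzChar2.lean`). [folklore] -/
theorem exists_face_read [IsGalois ℚ F] (hθ : ∀ P Q : GalT F, θ (P * Q) = θ P + θ Q) (hc : θ conjT = (1, 0))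
    (σ₀ : F →+* ℂ) (φ : Ty A) {i j : A} (hij : i ≠ j) :
    ∃ f : Face F, typeMap θ (pullType f.Φ σ₀) = φ ∧ (θ (translate σ₀ f.p)).2 = i ∧ (θ (translate σ₀ f.p')).2 = j := by
  have ht' : θ.symm (0, j) ∉ orb conjT (θ.symm (0, i)) := fun h => hij (by
    have e := (mem_orb_iff_snd_eq θ hθ hc _ _).mp h
    simp only [θ.apply_symm_apply] at e
    exact e.symm)
  refine ⟨faceOfG σ₀ (typeOf θ hθ hc φ) (θ.symm (0, i)) (θ.symm (0, j)) ht', ?_, ?_, ?_⟩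
  · show typeMap θ (pullType (pushType σ₀ (typeOf θ hθ hc φ)) σ₀) = φ
    rw [pullType_pushType, typeMap_typeOf]
  · show (θ (translate σ₀ ((θ.symm (0, i)).1 σ₀))).2 = i
    rw [translate_apply_eq, θ.apply_symm_apply]
  · show (θ (translate σ₀ ((θ.symm (0, j)).1 σ₀))).2 = j
    rw [translate_apply_eq, θ.apply_symm_apply]

omit [Fintype A] [DecidableEq A] in
/-- **A finite label family is read by finitely many tree faces**: for every finite `S ⊆ Ty A × A × A` with distinct places there is
a finite set `𝒮` of at most `|S|` faces of `F` reading every member of `S` at `σ₀`. [folklore] -/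
theorem exists_faces_read [IsGalois ℚ F] (hθ : ∀ P Q : GalT F, θ (P * Q) = θ P + θ Q) (hc : θ conjT = (1, 0))
    (σ₀ : F →+* ℂ) (S : Finset (Ty A × A × A)) (hS : ∀ s ∈ S, s.2.1 ≠ s.2.2) :
    ∃ 𝒮 : Finset (Face F), 𝒮.card ≤ S.card ∧
      ∀ s ∈ S, ∃ R ∈ 𝒮, typeMap θ (pullType R.Φ σ₀) = s.1 ∧ (θ (translate σ₀ R.p)).2 = s.2.1 ∧
        (θ (translate σ₀ R.p')).2 = s.2.2 := by
  classical
  choose R hR using fun s : {s // s ∈ S} => exists_face_read θ hθ hc σ₀ s.1.1 (hS s.1 s.2)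
  refine ⟨Finset.univ.image R, ?_, fun s hs => ⟨R ⟨s, hs⟩, Finset.mem_image_of_mem R (Finset.mem_univ _), hR ⟨s, hs⟩⟩⟩
  calc (Finset.univ.image R).card ≤ (Finset.univ : Finset {s // s ∈ S}).card := Finset.card_image_le
    _ = S.card := by simp

/-! ## §3 The dictionary datum from the automorphism group -/

/-- **`Aut(F) ≃ GalT F` along a base embedding**: `g ↦` the Galois translate carrying `σ₀` to `σ₀ ∘ g` (a multiplicative bijection,
`CorCM/FaceCensusCells.lean` `translate_comp_mul`). [folklore] -/
def galTOfAut [IsGalois ℚ F] (σ₀ : F →+* ℂ) : (F ≃ₐ[ℚ] F) ≃ GalT F :=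
  Equiv.ofBijective (fun g => translate σ₀ (σ₀.comp (g : F →+* F))) (by
    constructor
    · intro g h hgh
      have h1 := congrArg (fun P : GalT F => P.1 σ₀) hgh
      simp only [translate_apply_self] at h1
      exact comp_aut_injective σ₀ h1
    · intro P
      obtain ⟨g, hg⟩ := exists_aut_eq σ₀ (P.1 σ₀)
      exact ⟨g, by simp only [← hg, translate_apply_eq]⟩)

/-- `galTOfAut σ₀ g = translate σ₀ (σ₀ ∘ g)`. [folklore] -/
theorem galTOfAut_apply [IsGalois ℚ F] (σ₀ : F →+* ℂ) (g : F ≃ₐ[ℚ] F) :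
    galTOfAut σ₀ g = translate σ₀ (σ₀.comp (g : F →+* F)) := rfl

/-- `galTOfAut σ₀ g` carries `σ₀` to `σ₀ ∘ g`. [folklore] -/
theorem galTOfAut_apply_base [IsGalois ℚ F] (σ₀ : F →+* ℂ) (g : F ≃ₐ[ℚ] F) :
    (galTOfAut σ₀ g).1 σ₀ = σ₀.comp (g : F →+* F) := by
  rw [galTOfAut_apply, translate_apply_self]

/-- … and conversely `σ₀ ∘ (galTOfAut σ₀)⁻¹ P = P σ₀`. [folklore] -/
theorem comp_galTOfAut_symm [IsGalois ℚ F] (σ₀ : F →+* ℂ) (P : GalT F) :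
    σ₀.comp (((galTOfAut σ₀).symm P : F ≃ₐ[ℚ] F) : F →+* F) = P.1 σ₀ := by
  conv_rhs => rw [← (galTOfAut σ₀).apply_symm_apply P]
  rw [galTOfAut_apply_base]

/-- `galTOfAut` is multiplicative. [folklore] -/
theorem galTOfAut_mul [IsGalois ℚ F] (σ₀ : F →+* ℂ) (g h : F ≃ₐ[ℚ] F) :
    galTOfAut σ₀ (g * h) = galTOfAut σ₀ g * galTOfAut σ₀ h := by
  rw [galTOfAut_apply, galTOfAut_apply, galTOfAut_apply, translate_comp_mul]

/-- … and so is its inverse. [folklore] -/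
theorem galTOfAut_symm_mul [IsGalois ℚ F] (σ₀ : F →+* ℂ) (P Q : GalT F) :
    (galTOfAut σ₀).symm (P * Q) = (galTOfAut σ₀).symm P * (galTOfAut σ₀).symm Q := by
  apply (galTOfAut σ₀).injective
  rw [galTOfAut_mul, Equiv.apply_symm_apply, Equiv.apply_symm_apply, Equiv.apply_symm_apply]

/-- The automorphism inducing complex conjugation at `σ₀` goes to `conjT`. [folklore] -/
theorem galTOfAut_conjAut [IsGalois ℚ F] (σ₀ : F →+* ℂ) {c : F ≃ₐ[ℚ] F} (hcσ : σ₀.comp (c : F →+* F) = conjugate σ₀) :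
    galTOfAut σ₀ c = conjT := by
  rw [galTOfAut_apply, hcσ, ← conjT_eq_translate]

omit [Fintype A] [DecidableEq A] in
/-- **The dictionary datum from an `Aut`-datum.**  A bijection `ε : Aut(F) ≃ ℤ/2 × A`, multiplicative-to-additive and carrying the
complex conjugation at `σ₀` to `(1, 0)`, gives the dictionary datum `θ = ε ∘ (galTOfAut σ₀)⁻¹` on `GalT F`. [folklore] -/
theorem autDatum [IsGalois ℚ F] (σ₀ : F →+* ℂ) (ε : (F ≃ₐ[ℚ] F) ≃ ZMod 2 × A)
    (hε : ∀ g h : F ≃ₐ[ℚ] F, ε (g * h) = ε g + ε h) {c : F ≃ₐ[ℚ] F} (hcσ : σ₀.comp (c : F →+* F) = conjugate σ₀)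
    (hεc : ε c = (1, 0)) :
    (∀ P Q : GalT F, ((galTOfAut σ₀).symm.trans ε) (P * Q) =
        ((galTOfAut σ₀).symm.trans ε) P + ((galTOfAut σ₀).symm.trans ε) Q) ∧
      ((galTOfAut σ₀).symm.trans ε) conjT = (1, 0) := by
  refine ⟨fun P Q => ?_, ?_⟩
  · simp only [Equiv.trans_apply, galTOfAut_symm_mul, hε]
  · rw [Equiv.trans_apply, ← galTOfAut_conjAut σ₀ hcσ, Equiv.symm_apply_apply, hεc]

omit [AddCommGroup A] [Fintype A] [DecidableEq A] in
/-- Under the `Aut`-datum, the translate to `σ₀ ∘ g` reads `ε g`. [folklore] -/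
theorem autDatum_translate [IsGalois ℚ F] (σ₀ : F →+* ℂ) (ε : (F ≃ₐ[ℚ] F) ≃ ZMod 2 × A) (g : F ≃ₐ[ℚ] F) :
    ((galTOfAut σ₀).symm.trans ε) (translate σ₀ (σ₀.comp (g : F →+* F))) = ε g := by
  rw [Equiv.trans_apply, ← galTOfAut_apply, Equiv.symm_apply_apply]

omit [AddCommGroup A] [Fintype A] [DecidableEq A] in
/-- **Type reads under the `Aut`-datum**: if `σ₀ ∘ g ∈ Θ ↔ (ε g).1 = φ (ε g).2` for all automorphisms `g`, then `pullType Θ σ₀` has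
label `φ`. [folklore] -/
theorem typeMap_eq_of_autReads [IsGalois ℚ F] (σ₀ : F →+* ℂ) (ε : (F ≃ₐ[ℚ] F) ≃ ZMod 2 × A) (Θ : CMType F) {φ : Ty A}
    (hΘ : ∀ g : F ≃ₐ[ℚ] F, σ₀.comp (g : F →+* F) ∈ Θ.1 ↔ (ε g).1 = φ (ε g).2) :
    typeMap ((galTOfAut σ₀).symm.trans ε) (pullType Θ σ₀) = φ := by
  funext y
  unfold typeMap
  have hm : ((galTOfAut σ₀).symm.trans ε).symm (0, y) ∈ (pullType Θ σ₀).1 ↔ (0 : ZMod 2) = φ y := by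
    rw [mem_pullType, Equiv.symm_trans_apply, Equiv.symm_symm, galTOfAut_apply_base, hΘ, Equiv.apply_symm_apply]
  have h01 : ∀ u : ZMod 2, u = 0 ∨ u = 1 := by decide
  by_cases h : ((galTOfAut σ₀).symm.trans ε).symm (0, y) ∈ (pullType Θ σ₀).1
  · rw [if_pos h]; exact hm.mp h
  · rw [if_neg h]
    rcases h01 (φ y) with h0 | h1
    · exact absurd (hm.mpr h0.symm) h
    · exact h1.symm

/-! ## §4 The transport theorem: generation in b09's model gives `hgen` -/

/-- **The transport of the generating module.**  If a set `𝒮` of tree faces reads every member of the label family `S` at `σ₀`,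
then `transport` maps `pairs A ⊔ span ℤ {transl g (faceVec s) | g, s ∈ S}` into
`span ℤ {weightRel g.corner (fun _ ↦ {σ}) | g ∈ 𝒮, σ} ⊔ pairRel`. [folklore] -/
theorem transport_mem_of_mem_sup_span [IsGalois ℚ F] (hθ : ∀ P Q : GalT F, θ (P * Q) = θ P + θ Q) (hc : θ conjT = (1, 0))
    (S : Finset (Ty A × A × A)) (σ₀ : F →+* ℂ) (𝒮 : Set (Face F))
    (hreads : ∀ s ∈ S, ∃ R ∈ 𝒮, typeMap θ (pullType R.Φ σ₀) = s.1 ∧ (θ (translate σ₀ R.p)).2 = s.2.1 ∧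
      (θ (translate σ₀ R.p')).2 = s.2.2)
    {v : Ty A → ℤ} (hv : v ∈ pairs A ⊔
      Submodule.span ℤ {w : Ty A → ℤ | ∃ g : ZMod 2 × A, ∃ s ∈ S, w = transl A g (faceVec A s.1 s.2.1 s.2.2)}) :
    transport θ hθ hc v ∈ Submodule.span ℤ {y : CMF (GalT F) conjT →₀ ℤ | ∃ g ∈ 𝒮, ∃ σ : F →+* ℂ,
        y = weightRel g.corner (fun _ => ({σ} : Finset (F →+* ℂ)))} ⊔ pairRel := by
  obtain ⟨p, hp, w, hw, rfl⟩ := Submodule.mem_sup.mp hv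
  rw [map_add]
  refine Submodule.add_mem _ (Submodule.mem_sup_right ?_) (Submodule.mem_sup_left ?_)
  · have hle : Submodule.map (transport θ hθ hc) (pairs A) ≤ (pairRel : Submodule ℤ (CMF (GalT F) conjT →₀ ℤ)) := by
      unfold pairs
      refine Submodule.map_span_le _ _ _ |>.mpr ?_
      rintro _ ⟨φ, rfl⟩
      exact transport_pairVec_mem θ hθ hc φ
    exact hle (Submodule.mem_map_of_mem hp)
  · have hle : Submodule.map (transport θ hθ hc)
        (Submodule.span ℤ {w : Ty A → ℤ | ∃ g : ZMod 2 × A, ∃ s ∈ S, w = transl A g (faceVec A s.1 s.2.1 s.2.2)}) ≤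
        Submodule.span ℤ {y : CMF (GalT F) conjT →₀ ℤ | ∃ g ∈ 𝒮, ∃ σ : F →+* ℂ,
          y = weightRel g.corner (fun _ => ({σ} : Finset (F →+* ℂ)))} := by
      refine Submodule.map_span_le _ _ _ |>.mpr ?_
      rintro _ ⟨g, s, hs, rfl⟩
      obtain ⟨R, hR, hΦ, hp', hq'⟩ := hreads s hs
      rw [transport_transl_faceVec θ hθ hc R σ₀ hΦ hp' hq' g]
      exact Submodule.subset_span ⟨R, hR, _, rfl⟩
    exact hle (Submodule.mem_map_of_mem hw)

/-- **THE ODD-SLICE TRANSPORT (corner-indicator form).**  For a Galois CM field `F` with dictionary datum `θ : GalT F ≃ ℤ/2 × A`: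
if in b09's model the Hodge lattice is generated, together with the divisor pairs, by the Galois translates of the face classes of
a finite label family `S` — `hodge A ≤ pairs A ⊔ span ℤ {transl g (faceVec s) | g, s ∈ S}` — and a set `𝒮` of faces of `F` reads
every member of `S` at `σ₀`, then the corner indicator of EVERY face of `F`, read at `σ₀`, lies in
`span ℤ {weightRel g.corner (fun _ ↦ {σ}) | g ∈ 𝒮, σ} ⊔ pairRel`. [cite: Pohlmann1968, Thm. 1] -/
theorem weightRel_mem_of_hodge_le [IsGalois ℚ F] (hθ : ∀ P Q : GalT F, θ (P * Q) = θ P + θ Q) (hc : θ conjT = (1, 0))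
    (S : Finset (Ty A × A × A))
    (hS : hodge A ≤ pairs A ⊔
      Submodule.span ℤ {w : Ty A → ℤ | ∃ g : ZMod 2 × A, ∃ s ∈ S, w = transl A g (faceVec A s.1 s.2.1 s.2.2)})
    (σ₀ : F →+* ℂ) (𝒮 : Set (Face F))
    (hreads : ∀ s ∈ S, ∃ R ∈ 𝒮, typeMap θ (pullType R.Φ σ₀) = s.1 ∧ (θ (translate σ₀ R.p)).2 = s.2.1 ∧
      (θ (translate σ₀ R.p')).2 = s.2.2)
    (f : Face F) :
    weightRel f.corner (fun _ => ({σ₀} : Finset (F →+* ℂ))) ∈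
      Submodule.span ℤ {y : CMF (GalT F) conjT →₀ ℤ | ∃ g ∈ 𝒮, ∃ σ : F →+* ℂ,
        y = weightRel g.corner (fun _ => ({σ} : Finset (F →+* ℂ)))} ⊔ pairRel := by
  rw [← transport_faceVec θ hθ hc f σ₀ rfl rfl rfl]
  exact transport_mem_of_mem_sup_span θ hθ hc S σ₀ 𝒮 hreads
    (hS (faceVec_mem A _ (snd_ne_of_face θ hθ hc f σ₀)))

/-- **THE ODD-SLICE TRANSPORT (`hgen` form).**  Under the hypotheses of `weightRel_mem_of_hodge_le`, the INT2-GEN generation binder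
`hgen(𝒮, σ₀)` of `CorCM/FacePeriodsGeneratingSet.lean` holds: the `σ₀`-Weil character of the corner product of EVERY face of `F` lies
in the subgroup generated by the Weil characters of the faces of `𝒮` at all base embeddings.
[cite: Pohlmann1968, Thm. 1] [cite: Milne1999LefschetzClasses, Thm. 3.2] -/
theorem hgen_of_hodge_le [IsGalois ℚ F] (hθ : ∀ P Q : GalT F, θ (P * Q) = θ P + θ Q) (hc : θ conjT = (1, 0))
    (S : Finset (Ty A × A × A))
    (hS : hodge A ≤ pairs A ⊔
      Submodule.span ℤ {w : Ty A → ℤ | ∃ g : ZMod 2 × A, ∃ s ∈ S, w = transl A g (faceVec A s.1 s.2.1 s.2.2)})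
    (σ₀ : F →+* ℂ) (𝒮 : Set (Face F))
    (hreads : ∀ s ∈ S, ∃ R ∈ 𝒮, typeMap θ (pullType R.Φ σ₀) = s.1 ∧ (θ (translate σ₀ R.p)).2 = s.2.1 ∧
      (θ (translate σ₀ R.p')).2 = s.2.2)
    (f : Face F) :
    lefChar f.corner (fun _ => ({σ₀} : Finset (F →+* ℂ))) ∈ AddSubgroup.closure
      {a : Asym F | ∃ g ∈ 𝒮, ∃ σ : F →+* ℂ, a = lefChar g.corner (fun _ => ({σ} : Finset (F →+* ℂ)))} :=
  hgen_of_weightRel_mem_span 𝒮 σ₀ (weightRel_mem_of_hodge_le θ hθ hc S hS σ₀ 𝒮 hreads) f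

/-- **`hgen` for a finite face set of the size of the label family** (§2 non-vacuity + §4): a generation statement for `S` in b09's
model yields a finite set of at most `|S|` faces of `F` whose Weil characters generate those of all faces of `F`.
[cite: Pohlmann1968, Thm. 1] [cite: Milne1999LefschetzClasses, Thm. 3.2] -/
theorem exists_faces_hgen_of_hodge_le [IsGalois ℚ F] (hθ : ∀ P Q : GalT F, θ (P * Q) = θ P + θ Q) (hc : θ conjT = (1, 0))
    (S : Finset (Ty A × A × A)) (hS' : ∀ s ∈ S, s.2.1 ≠ s.2.2)
    (hS : hodge A ≤ pairs A ⊔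
      Submodule.span ℤ {w : Ty A → ℤ | ∃ g : ZMod 2 × A, ∃ s ∈ S, w = transl A g (faceVec A s.1 s.2.1 s.2.2)})
    (σ₀ : F →+* ℂ) :
    ∃ 𝒮 : Finset (Face F), 𝒮.card ≤ S.card ∧ ∀ f : Face F,
      lefChar f.corner (fun _ => ({σ₀} : Finset (F →+* ℂ))) ∈ AddSubgroup.closure
        {a : Asym F | ∃ g ∈ (𝒮 : Set (Face F)), ∃ σ : F →+* ℂ,
          a = lefChar g.corner (fun _ => ({σ} : Finset (F →+* ℂ)))} := by
  obtain ⟨𝒮, hcard, hreads⟩ := exists_faces_read θ hθ hc σ₀ S hS'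
  exact ⟨𝒮, hcard, hgen_of_hodge_le θ hθ hc S hS σ₀ (𝒮 : Set (Face F))
    (fun s hs => by obtain ⟨R, hR, h⟩ := hreads s hs; exact ⟨R, Finset.mem_coe.mpr hR, h⟩)⟩

end Summit.HodgeConjecture.CorCM.FaceCensus.OddSlice

end
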